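import Summits.BirchSwinnertonDyer.Rank1Residual.X2.GreenbergVatsalAnalyticTransferLe
import Summits.BirchSwinnertonDyer.Rank1Residual.X2.GreenbergVatsalInputs
import Literature.NumberTheory.EllipticCurves.Wuthrich2014.ReducibleMultiplicativeDivisibility
import HarnessLib

/-!
# Class X2a, GV CASE 1 at an odd multiplicative Eisenstein prime WITHOUT the datum record:
# the `λ`/`μ^anal` clause from A40/A41, A135, Greenberg Prop. 5.10, Wuthrich Thm. 16 and the two
# displayed shapes — cell `b2b-bsdres`, unit `b2b-bsdres-eisenstein-p2`, gen 30 (F7c)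

HONEST FRAMING (run/shared/lean/b2b/bsd-rank1-residual/, verbatim in every file): the goal of the
cell is to DELETE the COMBINATION-SHAPED residual classes of the Birch–Swinnerton-Dyer formula for
ALL analytic-rank `≤ 1` elliptic curves over `ℚ` — "full BSD formula for every rank `≤ 1` curve in
class `C`" assembled STRICTLY from published theorems — so that the rank-`≤ 1` remainder becomes
exactly the CONSTRUCTION-SHAPED classes, which are TYPED (missing-input `Prop`s), NOT attempted.
This is not "finishing BSD". Research route; NO CLAIM BEYOND STATED CLASSES; nothing here changes a
label. Theorems only; no definition, no named fact, no `sorry`.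

WHAT. Gen 17's `GreenbergVatsalCaseOne.caseOne_clause_of_shapes` proved CASE 1 (rational line
ramified at `p` and even) of the flag's clause `λ(ϖ·L_p) = λ(T^e f_E)`, `μ(ϖ·L_p) = 0` from the
registered algebraic facts A40/A41, A133, A135, A137, Greenberg Prop. 5.10 and the two displayed
shapes (`hLift`, `hAn`). A133 and A137 came from the datum record T-GV23L and A137′. Gen 30 proved
their UPPER HALVES in the kernel (`GreenbergVatsalAnalyticTransferLe`: `ord_T(b mod p) ≤
ord_T(T^e f_E mod p)` for any `b` with `ι b = ϖ·L_p`), and the LOWER HALF is Wuthrich 2014 Thm. 16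
(A33, ALREADY a binder of the X2a closure): `ϖ·L_p = ι(T^e g)` with `g ∈ char X = (f_E)`, so
`b = T^e·g = T^e·f_E·c` by injectivity of `ι`, whence `ord_T(b mod p) ≥ ord_T(T^e f_E mod p)`.

* `exists_finset_bad_not_mem_bad` — the cell's `Σ₀` (bad places `≠ p`), with badness exported;
* `order_map_eq_of_le_of_mem_span` — the algebra `≤` + divisibility `⟹` `=` in `𝔽_p⟦T⟧`;
* **`caseOne_clause_of_shapes_le`** — CASE 1 of the clause (conclusion LITERALLY that of
  `caseOne_clause_of_shapes`) from {A40 `hT`, A41 `hT'`, A135 `hB`, Prop. 5.10 `hG`, A33 `hWu`,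
  `hLift`, `hAn`} and the cyclotomic-variable matching `hγ'` (needed by A33). NOT used: A133, A137,
  A137′, T-GV23L;
* **`caseOne_clause_of_inputs_le`** — the same over the TYPED inputs `GVLiftingInput` /
  `GVAnalyticInput`.

References: [GreenbergVatsal2000] §2 (16), pp. 28–30; §3 Thm. (3.11), (26)–(28), p. 43; p. 20;
[GreenbergLNM1716] Prop. 5.10; [Wuthrich2014] Thm. 16 (p. 397); HOME/b2b-bsdres-eisenstein-p2/X2-GAP.md §35.
-/

set_option autoImplicit false

noncomputable section

open scoped Classical AddSubgroup MatrixGroups ModularForm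

open PowerSeries NumberField IsDedekindDomain Field WeierstrassCurve CongruenceSubgroup
  Literature.NumberTheory.EllipticCurves Literature.NumberTheory.EllipticCurves.GreenbergVatsal2000
  Literature.NumberTheory.EllipticCurves.ModularForms
  Literature.NumberTheory.EllipticCurves.Rank1Residual
  Summit.BirchSwinnertonDyer.Rank1Residual.X2.EulerFactorAlgebra
  Summit.BirchSwinnertonDyer.Rank1Residual.X2.EulerFactorInvariants
  Summit.BirchSwinnertonDyer.Rank1Residual.X2.GreenbergVatsalAnalyticTransferCore
  Summit.BirchSwinnertonDyer.Rank1Residual.X2.GreenbergVatsalAnalyticTransferLe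

namespace Summit.BirchSwinnertonDyer.Rank1Residual.X2.GreenbergVatsalCaseOneLe

/-! ## §1. `Σ₀` and the algebra -/

/-- **A finite BAD `Σ₀ ∌ p` containing every bad place `≠ p` exists**: the bad places not above `p`
(finite by `WeierstrassCurve.eventually_hasGoodReductionAt`). GV p. 42. -/
theorem exists_finset_bad_not_mem_bad (W : WeierstrassCurve ℚ) [W.IsElliptic] (p : ℕ) :
    ∃ S₀ : Finset (HeightOneSpectrum (𝓞 ℚ)),
      (∀ v ∈ S₀, ((p : ℕ) : 𝓞 ℚ) ∉ v.asIdeal) ∧ (∀ v ∈ S₀, ¬ W.HasGoodReductionAt v) ∧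
        ∀ v : HeightOneSpectrum (𝓞 ℚ), v ∉ S₀ → ((p : ℕ) : 𝓞 ℚ) ∉ v.asIdeal →
          W.HasGoodReductionAt v := by
  have hbadfin : {v : HeightOneSpectrum (𝓞 ℚ) | ¬ W.HasGoodReductionAt v}.Finite := by
    have h := W.eventually_hasGoodReductionAt
    rwa [Filter.eventually_cofinite] at h
  refine ⟨hbadfin.toFinset.filter (fun v => ((p : ℕ) : 𝓞 ℚ) ∉ v.asIdeal),
    fun v hv => (Finset.mem_filter.mp hv).2,
    fun v hv => hbadfin.mem_toFinset.mp (Finset.mem_filter.mp hv).1, fun v hv hpv => ?_⟩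
  by_contra hbad
  exact hv (Finset.mem_filter.mpr ⟨hbadfin.mem_toFinset.mpr hbad, hpv⟩)

/-- **`≤` + divisibility `⟹` `=`** (GV p. 20 read with an inequality): if `b = a·g` with
`g ∈ (f_E)` and `ord_T(b mod p) ≤ ord_T(a·f_E mod p)`, then `ord_T(b mod p) = ord_T(a·f_E mod p)` —
`g = c·f_E` makes `b̄ = (a·f_E)‾ · c̄`, so `ord_T(b̄) ≥ ord_T((a·f_E)‾)` since orders add in `𝔽_p⟦T⟧`.
[cite: GreenbergVatsal2000, p. 20 (arXiv p. 4)] -/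
theorem order_map_eq_of_le_of_mem_span {p : ℕ} [Fact p.Prime] {a b g fE : IwasawaAlgebra p}
    (hg : g ∈ Ideal.span {fE}) (hb : b = a * g)
    (hle : (PowerSeries.map (PadicInt.toZMod (p := p)) b).order ≤
      (PowerSeries.map (PadicInt.toZMod (p := p)) (a * fE)).order) :
    (PowerSeries.map (PadicInt.toZMod (p := p)) b).order =
      (PowerSeries.map (PadicInt.toZMod (p := p)) (a * fE)).order := by
  obtain ⟨c, hc⟩ := Ideal.mem_span_singleton'.1 hg
  have hb' : b = (a * fE) * c := by rw [hb, ← hc]; ring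
  refine le_antisymm hle ?_
  rw [hb', map_mul (PowerSeries.map (PadicInt.toZMod (p := p))) (a * fE) c, PowerSeries.order_mul]
  exact le_self_add

/-! ## §2. CASE 1 of the clause without the datum record -/

/-- **CASE 1 of the flag's named fact WITHOUT T-GV23L / A137′.** Conclusion: LITERALLY the body of
`GreenbergVatsal2000.lambda_muAnal_multiplicative_of_gvPar` for `(W, p, κ, γ, f, D, ϖ, f_E)` with
`GVPar` replaced by a rational line `Φ₀` RAMIFIED at `p` and EVEN (as in gen 17's
`caseOne_clause_of_shapes`). Hypotheses: A40/A41 (`hT`, `hT'`), A135 (`hB`), Greenberg 1999 Prop. 5.10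
(`hG`), Wuthrich 2014 Thm. 16 (`hWu`); the shapes `hLift` (GV p. 30) and `hAn` (GV Thm. (3.11) + (28)
+ p. 43) at every admissible `Σ₀`; and `γ` matching the cyclotomic variable (`hγ'`, for `hWu`).
Proof: `Σ₀ :=` the bad places `≠ p`; upper half by `GreenbergVatsalAnalyticTransferLe`; lower half by
`hWu` (`b = T^e·g`, `g ∈ (f_E)`) and `order_map_eq_of_le_of_mem_span`.
[cite: GreenbergVatsal2000, §2 (16), pp. 28–30; §3 Thm. (3.11), (28), p. 43; p. 20]
[cite: Wuthrich2014, Thm. 16 (p. 397)] [cite: GreenbergLNM1716, Prop. 5.10 (PDF p. 147)] -/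
theorem caseOne_clause_of_shapes_le
    (hT : Silverman1994_thmV53_tateUniformisation.{0})
    (hT' : Silverman1994_thmV53_corV54_tateUniformisation.{0})
    (hB : datumSelmer_divisible_of_finite_torsionBy)
    (hG : Greenberg1999.prop510_isTorsion_hasUnitContent_of_gvPar)
    (hWu : Wuthrich2014.thm16_charIdeal_dvd_multiplicative_of_reducible)
    (hLift : ∀ (W : WeierstrassCurve ℚ) [W.IsGloballyMinimal] [W.IsElliptic] (p : ℕ) [Fact p.Prime]
      (κ : ZpExtension ℚ p) (S₀ : Finset (HeightOneSpectrum (𝓞 ℚ)))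
      (Φ₀ : AddSubgroup (W.geomTorsion (p : ℤ))) (hΦ : IsRationalLine W p Φ₀),
      p ≠ 2 → κ.IsCyclotomic → ¬ LineUnramifiedAt W p Φ₀ → LineEven W p Φ₀ →
      (∀ v ∈ S₀, ((p : ℕ) : 𝓞 ℚ) ∉ v.asIdeal) →
      (∀ v : HeightOneSpectrum (𝓞 ℚ), v ∉ S₀ → ((p : ℕ) : 𝓞 ℚ) ∉ v.asIdeal →
        W.HasGoodReductionAt v) →
      ∀ s ∈ ResidualDevissageSelmer.quotSelmer κ.kerSubgroup
          (ResidualDevissageLine.lineSub Φ₀ hΦ).Quot p (↑S₀ : Set (HeightOneSpectrum (𝓞 ℚ))),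
        ∃ x ∈ GreenbergVatsal2000.unramifiedOutside κ.kerSubgroup
            ↥((↥(W.geomPrimaryTorsion p))[(p : ℤ)]) p (↑S₀ : Set (HeightOneSpectrum (𝓞 ℚ))),
          ResidualDevissageSelmer.subH1 κ.kerSubgroup (ResidualDevissageLine.lineSub Φ₀ hΦ).proj
            (ResidualDevissageLine.lineSub Φ₀ hΦ).proj_smul x = s)
    (hAn : ∀ (W : WeierstrassCurve ℚ) [W.IsGloballyMinimal] [W.IsElliptic] (p : ℕ) [Fact p.Prime]
      (κ : ZpExtension ℚ p) {N : ℕ} [NeZero N] (f : CuspForm (Gamma0 N) 2)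
      (S₀ : Finset (HeightOneSpectrum (𝓞 ℚ)))
      (Φ₀ : AddSubgroup (W.geomTorsion (p : ℤ))) (hΦ : IsRationalLine W p Φ₀),
      p ≠ 2 → W.HasMultiplicativeReductionAtPrime p → κ.IsCyclotomic →
      ¬ LineUnramifiedAt W p Φ₀ → LineEven W p Φ₀ → IsNewformOf W f →
      (∀ v ∈ S₀, ((p : ℕ) : 𝓞 ℚ) ∉ v.asIdeal) →
      (∀ v : HeightOneSpectrum (𝓞 ℚ), v ∉ S₀ → ((p : ℕ) : 𝓞 ℚ) ∉ v.asIdeal →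
        W.HasGoodReductionAt v) →
      ∀ (ϖ : ℚ), (ϖ : ℝ) * W.realPeriodRat = plusPeriod f →
      ∀ (L : PowerSeries ℚ_[p]),
        (W.HasSplitMultiplicativeReductionAtPrime p → IsSplitMultPAdicLFunctionOf f p L) →
        (¬ W.HasSplitMultiplicativeReductionAtPrime p → IsMultPAdicLFunctionOf f p (-1) L) →
      ∀ (b : IwasawaAlgebra p),
        iwasawaToPowerSeries p b = PowerSeries.C ((ϖ : ℚ) : ℚ_[p]) * L →
        HasUnitContent (b * eulerFactorProduct W p S₀) ∧
          p ^ (PowerSeries.map (PadicInt.toZMod (p := p)) (b * eulerFactorProduct W p S₀)).order.toNat =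
            Nat.card (GreenbergVatsal2000.unramifiedOutside κ.kerSubgroup
                (ResidualDevissageLine.lineSub Φ₀ hΦ).Sub p (↑S₀ : Set (HeightOneSpectrum (𝓞 ℚ)))) *
              Nat.card (ResidualDevissageSelmer.quotSelmer κ.kerSubgroup
                (ResidualDevissageLine.lineSub Φ₀ hΦ).Quot p (↑S₀ : Set (HeightOneSpectrum (𝓞 ℚ)))))
    (W : WeierstrassCurve ℚ) [W.IsElliptic] [W.IsGloballyMinimal] (p : ℕ) [Fact p.Prime]
    {κ : ZpExtension ℚ p} {γ : absoluteGaloisGroup ℚ} {N : ℕ} [NeZero N]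
    {f : CuspForm (Gamma0 N) 2}
    (hp : p ≠ 2) (hmult : W.HasMultiplicativeReductionAtPrime p)
    {Φ₀ : AddSubgroup (W.geomTorsion (p : ℤ))} (hΦ : IsRationalLine W p Φ₀)
    (hram : ¬ LineUnramifiedAt W p Φ₀) (heven : LineEven W p Φ₀)
    (hκ : κ.IsCyclotomic) (hγ : κ.IsTopGenerator γ)
    (hγ' : IsCyclotomicVariable p γ) (hf : IsNewformOf W f)
    (D : W.SelmerDualData κ γ) (ϖ : ℚ) (hϖ : (ϖ : ℝ) * W.realPeriodRat = plusPeriod f)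
    (fE : IwasawaAlgebra p) (hchar : D.charIdeal = Ideal.span {fE}) :
    (W.HasSplitMultiplicativeReductionAtPrime p →
        ∀ (L : PowerSeries ℚ_[p]), IsSplitMultPAdicLFunctionOf f p L →
        ∀ (b : IwasawaAlgebra p), iwasawaToPowerSeries p b = PowerSeries.C ((ϖ : ℚ) : ℚ_[p]) * L →
          HasUnitContent b ∧
            (PowerSeries.map (PadicInt.toZMod (p := p)) b).order =
              (PowerSeries.map (PadicInt.toZMod (p := p)) (PowerSeries.X * fE)).order) ∧
      (¬ W.HasSplitMultiplicativeReductionAtPrime p →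
        ∀ (L : PowerSeries ℚ_[p]), IsMultPAdicLFunctionOf f p (-1) L →
        ∀ (b : IwasawaAlgebra p), iwasawaToPowerSeries p b = PowerSeries.C ((ϖ : ℚ) : ℚ_[p]) * L →
          HasUnitContent b ∧
            (PowerSeries.map (PadicInt.toZMod (p := p)) b).order =
              (PowerSeries.map (PadicInt.toZMod (p := p)) fE).order) := by
  -- the cell's standing data: bad Σ₀, finiteness, torsion, μ = 0, reducibility
  obtain ⟨S₀, hS₀, hbad, hS⟩ := exists_finset_bad_not_mem_bad W p
  haveI : Module.Finite (IwasawaAlgebra p) D.X :=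
    WeierstrassCurve.SelmerDualData.module_finite_of_isCyclotomic W κ hκ D hγ
  have hpar : GVPar W p := ⟨Φ₀, hΦ, Or.inl ⟨hram, heven⟩⟩
  have hred : ¬ W.HasIrreducibleModPGaloisRep p :=
    Rank1Residual.not_hasIrreducibleModPGaloisRep_of_isRationalLine hΦ
  obtain ⟨hX, g, hcharg, hug⟩ := hG.of_mult W p hp hmult hpar hκ hγ D
  have hμ : D.mu = 0 := (mu_eq_zero_iff_hasUnitContent D hX hcharg).mpr hug
  have hlift := hLift W p κ S₀ Φ₀ hΦ hp hκ hram heven hS₀ hS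
  obtain ⟨-, hWns, hWsplit⟩ := hWu W p hp hmult hred hκ hγ hγ' hf D ϖ hϖ
  refine ⟨fun hsplit L hL b hb => ?_, fun hns L hL b hb => ?_⟩
  · have hC := hAn W p κ f S₀ Φ₀ hΦ hp hmult hκ hram heven hf hS₀ hS ϖ hϖ L (fun _ => hL)
      (fun hns => absurd hsplit hns) b hb
    obtain ⟨hbu, hle⟩ := unitContent_and_order_le_of_card_eq_of_split W p κ S₀ hΦ hT hT' hB hκ hγ hp
      hsplit hS₀ hbad hS D hX hμ hram heven hlift hC hchar
    obtain ⟨g', hg', hιg'⟩ := hWsplit hsplit L hL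
    have hg'' : g' ∈ Ideal.span {fE} := hchar ▸ hg'
    have hbg : b = PowerSeries.X * g' := iwasawaToPowerSeries_injective p (hb.trans hιg'.symm)
    exact ⟨hbu, order_map_eq_of_le_of_mem_span hg'' hbg hle⟩
  · have hC := hAn W p κ f S₀ Φ₀ hΦ hp hmult hκ hram heven hf hS₀ hS ϖ hϖ L
      (fun hsplit => absurd hsplit hns) (fun _ => hL) b hb
    obtain ⟨hbu, hle⟩ := unitContent_and_order_le_of_card_eq_of_not_split W p κ S₀ hΦ hT hT' hB hκ hγ
      hp hmult hns hS₀ hbad hS D hX hμ hram heven hlift hC hchar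
    obtain ⟨g', hg', hιg'⟩ := hWns hns L hL
    have hg'' : g' ∈ Ideal.span {fE} := hchar ▸ hg'
    have hbg : b = 1 * g' := by rw [one_mul]; exact iwasawaToPowerSeries_injective p (hb.trans hιg'.symm)
    have hle' : (PowerSeries.map (PadicInt.toZMod (p := p)) b).order ≤
        (PowerSeries.map (PadicInt.toZMod (p := p)) (1 * fE)).order := by rwa [one_mul]
    have h := order_map_eq_of_le_of_mem_span hg'' hbg hle'
    rw [one_mul] at h
    exact ⟨hbu, h⟩

/-- **CASE 1 without the datum record, over the TYPED inputs** (`GVLiftingInput`, `GVAnalyticInput`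
at every admissible datum): gen 17's `caseOne_clause_of_inputs` with (A133, A137) replaced by
Wuthrich Thm. 16 (`hWu`) and `hγ'`. Conclusion unchanged.
[cite: GreenbergVatsal2000, §2 (16), pp. 28–30; §3 Thm. (3.11)] [cite: Wuthrich2014, Thm. 16 (p. 397)] -/
theorem caseOne_clause_of_inputs_le
    (hT : Silverman1994_thmV53_tateUniformisation.{0})
    (hT' : Silverman1994_thmV53_corV54_tateUniformisation.{0})
    (hB : datumSelmer_divisible_of_finite_torsionBy)
    (hG : Greenberg1999.prop510_isTorsion_hasUnitContent_of_gvPar)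
    (hWu : Wuthrich2014.thm16_charIdeal_dvd_multiplicative_of_reducible)
    (hLift : ∀ (W : WeierstrassCurve ℚ) [W.IsGloballyMinimal] [W.IsElliptic] (p : ℕ) [Fact p.Prime]
      (κ : ZpExtension ℚ p) (S₀ : Finset (HeightOneSpectrum (𝓞 ℚ)))
      (Φ₀ : AddSubgroup (W.geomTorsion (p : ℤ))) (hΦ : IsRationalLine W p Φ₀),
      p ≠ 2 → κ.IsCyclotomic → ¬ LineUnramifiedAt W p Φ₀ → LineEven W p Φ₀ →
      (∀ v ∈ S₀, ((p : ℕ) : 𝓞 ℚ) ∉ v.asIdeal) →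
      (∀ v : HeightOneSpectrum (𝓞 ℚ), v ∉ S₀ → ((p : ℕ) : 𝓞 ℚ) ∉ v.asIdeal →
        W.HasGoodReductionAt v) →
      GVLiftingInput W p κ S₀ Φ₀ hΦ)
    (hAn : ∀ (W : WeierstrassCurve ℚ) [W.IsGloballyMinimal] [W.IsElliptic] (p : ℕ) [Fact p.Prime]
      (κ : ZpExtension ℚ p) {N : ℕ} [NeZero N] (f : CuspForm (Gamma0 N) 2)
      (S₀ : Finset (HeightOneSpectrum (𝓞 ℚ)))
      (Φ₀ : AddSubgroup (W.geomTorsion (p : ℤ))) (hΦ : IsRationalLine W p Φ₀),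
      p ≠ 2 → W.HasMultiplicativeReductionAtPrime p → κ.IsCyclotomic →
      ¬ LineUnramifiedAt W p Φ₀ → LineEven W p Φ₀ → IsNewformOf W f →
      (∀ v ∈ S₀, ((p : ℕ) : 𝓞 ℚ) ∉ v.asIdeal) →
      (∀ v : HeightOneSpectrum (𝓞 ℚ), v ∉ S₀ → ((p : ℕ) : 𝓞 ℚ) ∉ v.asIdeal →
        W.HasGoodReductionAt v) →
      GVAnalyticInput W p κ f S₀ Φ₀ hΦ)
    (W : WeierstrassCurve ℚ) [W.IsElliptic] [W.IsGloballyMinimal] (p : ℕ) [Fact p.Prime]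
    {κ : ZpExtension ℚ p} {γ : absoluteGaloisGroup ℚ} {N : ℕ} [NeZero N]
    {f : CuspForm (Gamma0 N) 2}
    (hp : p ≠ 2) (hmult : W.HasMultiplicativeReductionAtPrime p)
    {Φ₀ : AddSubgroup (W.geomTorsion (p : ℤ))} (hΦ : IsRationalLine W p Φ₀)
    (hram : ¬ LineUnramifiedAt W p Φ₀) (heven : LineEven W p Φ₀)
    (hκ : κ.IsCyclotomic) (hγ : κ.IsTopGenerator γ)
    (hγ' : IsCyclotomicVariable p γ) (hf : IsNewformOf W f)
    (D : W.SelmerDualData κ γ) (ϖ : ℚ) (hϖ : (ϖ : ℝ) * W.realPeriodRat = plusPeriod f)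
    (fE : IwasawaAlgebra p) (hchar : D.charIdeal = Ideal.span {fE}) :
    (W.HasSplitMultiplicativeReductionAtPrime p →
        ∀ (L : PowerSeries ℚ_[p]), IsSplitMultPAdicLFunctionOf f p L →
        ∀ (b : IwasawaAlgebra p), iwasawaToPowerSeries p b = PowerSeries.C ((ϖ : ℚ) : ℚ_[p]) * L →
          HasUnitContent b ∧
            (PowerSeries.map (PadicInt.toZMod (p := p)) b).order =
              (PowerSeries.map (PadicInt.toZMod (p := p)) (PowerSeries.X * fE)).order) ∧
      (¬ W.HasSplitMultiplicativeReductionAtPrime p →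
        ∀ (L : PowerSeries ℚ_[p]), IsMultPAdicLFunctionOf f p (-1) L →
        ∀ (b : IwasawaAlgebra p), iwasawaToPowerSeries p b = PowerSeries.C ((ϖ : ℚ) : ℚ_[p]) * L →
          HasUnitContent b ∧
            (PowerSeries.map (PadicInt.toZMod (p := p)) b).order =
              (PowerSeries.map (PadicInt.toZMod (p := p)) fE).order) :=
  caseOne_clause_of_shapes_le hT hT' hB hG hWu
    (fun W _ _ p _ κ S₀ Φ₀ hΦ hp hκ hram heven hS₀ hS =>
      hLift W p κ S₀ Φ₀ hΦ hp hκ hram heven hS₀ hS)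
    (fun W _ _ p _ κ _ _ f S₀ Φ₀ hΦ hp hmult hκ hram heven hf hS₀ hS =>
      hAn W p κ f S₀ Φ₀ hΦ hp hmult hκ hram heven hf hS₀ hS)
    W p hp hmult hΦ hram heven hκ hγ hγ' hf D ϖ hϖ fE hchar

end Summit.BirchSwinnertonDyer.Rank1Residual.X2.GreenbergVatsalCaseOneLe

end
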